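import Summits.QuantumFields.BalabanUV.T4Continuum.Support.ShellMeasurePlaquetteCubicFrozenWitness
import Summits.QuantumFields.BalabanUV.T4Continuum.Support.ShellMeasureCommutatorLevels

/-!
# `T4Continuum.ShellMeasureCommutatorLevelsWitness` — crew rule G-1 RETRO-FIT for this lineage's S65 f5c END
# `ShellMeasureCommutatorLevels.prop4Hyp_locGrad_cubT_levels` (the `∇`-part of (98) at the live levels, star hypothesis +
# extension by zero, NO boundary words): it FIRES on a NONEMPTY block — `Λ` = the four bonds of `p₀`, `Pl` = the five
# plaquettes of their stars (read through extension by zero: the letters off `Λ` are zeros, not variables)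
(cell `pub-balaban`, sub-cell `t4`, spine estimate NE7c (node U5b); NE7c ROUND-2 crew, unit
`b2b-balaban-t4-ne7c-formalise-leaf-02` gen 9; F-ne7cleaf02g9-1's census listed f5c as «NOT affected (star + extension by
zero, no `bd`) — inhabited by a box»; this file is that inhabitation in kernel (owner's rule G-1, R-ne7cp1-g32-3 (2));
ADDITIVE — imports part 6 `ShellMeasurePlaquetteCubicFrozenWitness` (toy data) and f5c `ShellMeasureCommutatorLevels` ONLY;
[folklore]; 0 `def`, 0 `def … : Prop`, 0 sorry, 0 citation tags)

HONEST FRAMING.  Finite four-torus programme, rung (B)+1 only — NOT infinite volume, NOT a mass gap, NOT the Clay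
problem, NOT summit progress; (B), `BetaPertHyp`, (B^μ) are not consumed.  NE7c (`T4IndicatorShell.ShellWeightBound`)
is NOT PRINTED in [Balaban 1983–89] and NOT PROVED; «NE7c ⇐ the named binders» (trigger c3).  A TOY certifying that f5c's
binder shapes are jointly inhabited with `Λ ≠ ∅`; nothing printed is asserted; nothing of Bałaban's is discharged.
HONEST DEPENDENCY (cell): continuum YM on T⁴ ⇐ BetaPertH ∧ nine spine estimates (0/9 proved); BetaPertH ⇐ (D1) ∧ (D4) ∧
CAP+tail; G-an2-4 gates asym, D1 and NE2/3/4.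

THE TOY.  `d = 2`; `Λ := toyΛ` (part 4: the four bonds of `p₀`, nonempty); `Pl := frPl` (part 6: the five plaquettes of
the stars — f5c's `cubT Λ Pl …` reads the field through `ext Λ` = extension by zero, so plaquettes with letters off `Λ`
are legitimate: the global star hypothesis `hst : ∀ b : ↥Λ, plaqStar b ⊆ Pl` is CONSISTENT here, unlike in the `bd`-worded
ENDs of F-ne7cleaf02g9-1); `U₀ ≡ 1`, `η = 1`, unit weights, `Lc = 1`, ∇-datum `covD toyΛ 1 toyU`; any weight `w : ℂ`,
any radius `a₃`, any complete normed algebra with a tracial `τ`.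
* `toy_hst_ext` (f5c's `hst` on the toy = part 6's `fr_hst`), **`toy_cubT_fires`** (f5c's END APPLIED, every hypothesis
  discharged in kernel: `Prop4Hyp (Y ↦ locGrad (cubT toyΛ frPl w τ 1 1) Y) (144·1·‖w‖‖τ‖·1) a₃` from
  `WMax unitW unitW (covD …)` to `WSup unitW 3`).
Nothing in the countdown moves; NE7c NOT PROVED; spine PROVED 0∕9.
-/

noncomputable section

open scoped BigOperators

namespace Summit.QuantumFields.BalabanUV.T4Continuum.ShellMeasureCommutatorLevelsWitness

open Literature.MathematicalPhysics.QuantumFieldTheory.Balaban1983to89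
open B7Prop1Explicit (e U1)
open B8Ineq132 (covDerivFwd)
open B11Prop6Scheme (Prop4Hyp)
open Summit.QuantumFields.BalabanUV.T4Continuum.ShellMeasureCommutatorVariation (plaqStar)
open Summit.QuantumFields.BalabanUV.T4Continuum.ShellMeasureCommutatorLocGrad (ext cubT)
open Summit.QuantumFields.BalabanUV.T4Continuum.ShellMeasureCommutatorCovDatum (covIdx covD unitW unitW_apply)
open Summit.QuantumFields.BalabanUV.T4Continuum.ShellMeasureCommutatorLevels (prop4Hyp_locGrad_cubT_levels)
open Summit.QuantumFields.BalabanUV.T4Continuum.ShellMeasureLocalGradientTail (locGrad)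
open Summit.QuantumFields.BalabanUV.T4Continuum.ShellMeasureMultiGridNorms (WSup)
open Summit.QuantumFields.BalabanUV.T4Continuum.ShellMeasureMultiGridNormsMax (WMax)
open Summit.QuantumFields.BalabanUV.T4Continuum.ShellMeasurePlaquetteCubicLocatedDichWitness
  (toyΛ toy_nonempty toyU toy_h₀ toy_hDv)
open Summit.QuantumFields.BalabanUV.T4Continuum.ShellMeasurePlaquetteCubicFrozenWitness (frPl fr_hincr fr_hst incl)

export B7Prop1Explicit (Site)

variable {𝔸 : Type*} [NormedRing 𝔸] [NormOneClass 𝔸] [NormedAlgebra ℂ 𝔸] (τ : 𝔸 →L[ℂ] ℂ)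

omit [NormedRing 𝔸] [NormOneClass 𝔸] [NormedAlgebra ℂ 𝔸] τ in
/-- **f5c's GLOBAL STAR HYPOTHESIS HOLDS ON THE TOY**: the star of every bond of `toyΛ` lies in `frPl` (part 6's `fr_hst`,
read without the inclusion into the letters — f5c has no letter set, it extends by zero). [folklore] -/
theorem toy_hst_ext : ∀ b : ↥toyΛ, plaqStar b.1.1 b.1.2 ⊆ frPl := fun b => fr_hst b

omit [NormedRing 𝔸] [NormOneClass 𝔸] [NormedAlgebra ℂ 𝔸] τ in
/-- The block is nonempty (part 4). [folklore] -/
theorem toy_nonempty' : toyΛ.Nonempty := toy_nonempty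

/-- **f5c's END FIRES ON A NONEMPTY BLOCK (rule G-1 retro-fit).**  `ShellMeasureCommutatorLevels.prop4Hyp_locGrad_cubT_levels`
APPLIED to `Λ := toyΛ`, `Pl := frPl`, `U₀ ≡ 1`, `η = 1`, unit weights (`wt = Wf = Wd = unitW`, `wd = unitW`), `Lc = 1`,
∇-datum `covD toyΛ 1 toyU`, any `w : ℂ`, any `a₃`, any complete normed algebra with tracial `τ` — every hypothesis
discharged in kernel. [folklore] -/
theorem toy_cubT_fires (w : ℂ) (htr : ∀ P Q : 𝔸, τ (P * Q) = τ (Q * P)) (a₃ : ℝ) :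
    Prop4Hyp (fun Y : WMax (unitW ↥toyΛ) (unitW ↥(covIdx toyΛ)) (covD (𝔸 := 𝔸) toyΛ 1 (toyU 𝔸)) =>
        (WSup.toPiL (unitW ↥toyΛ) 3).symm
          (locGrad (cubT toyΛ frPl w τ 1 (toyU 𝔸))
            (WMax.toPiL (unitW ↥toyΛ) (unitW ↥(covIdx toyΛ)) (covD (𝔸 := 𝔸) toyΛ 1 (toyU 𝔸)) Y)))
      (144 * (((2 : ℕ) : ℝ) - 1) * ‖w‖ * ‖τ‖ * (1 : ℝ) ^ 3) a₃ :=
  prop4Hyp_locGrad_cubT_levels toyΛ frPl w (unitW ↥toyΛ) (unitW ↥(covIdx toyΛ)) (covD (𝔸 := 𝔸) toyΛ 1 (toyU 𝔸))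
    (unitW ↥toyΛ) (unitW ↥toyΛ) one_pos toy_h₀ htr fr_hincr toy_hst_ext le_rfl (fun _ => one_pos) (fun _ => one_pos)
    (fun _ _ _ => le_rfl) (fun _ => by simp) (fun _ => by simp) toy_hDv a₃

end Summit.QuantumFields.BalabanUV.T4Continuum.ShellMeasureCommutatorLevelsWitness

end
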